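import Mathlib
import Summits.ValiantsHypothesis.ValiantsHypothesis.Theorems.GaugeDescentDescentGlueTransfer
import Summits.ValiantsHypothesis.ValiantsHypothesis.Theorems.NumTameLowDegreeReduction
import Literature.Computability.AlgebraicComplexity.CommutativeExtensionSimulation
import Literature.Computability.AlgebraicComplexity.ValiantConjecture
import HarnessLib

/-!
# Route GaugeDescent — `DescentGlue` (stmt-ValiantsHypothesis-6637), part E: reduction of a
# skeleton identity for `per_n` over a number field modulo a good prime

Let `Q ∈ ℤ[x, y]` be a constant-free fan-in-two skeleton with `Q(x, y) = per_n` for a point `y`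
whose coordinates lie in a number field `K ⊂ ℂ` of degree `D` and are integral over `ℤ[1/M]`
(`M^e y_v` is an algebraic integer for some `e`). Then for every prime `p ∤ M`,
`L_{ℤ/p}(per_n) ≤ (5D³ + 6D² + 2D) · |Q| + 3D` (`complexity_perPoly_zmod_le_of_point`).

Proof (all currency in the tree): `A = ℤ[M^e y_v : v] ⊂ K` is a finite free `ℤ`-algebra of rank
`≤ D` (`finrank_int_le_of_le`, val-lit p7 g6); in the localisation `A[1/M]` the point `y` has the
avatar `ỹ_v = (M^e y_v)/M^e`, which satisfies every integer polynomial relation of `y` (the map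
`A[1/M] → ℂ` is injective); `B = A/pA` is a `ZMod p`-algebra of dimension `≤ D`
(`finite_and_finrank_zmod_quotient_le`) in which `M` is a unit (`p ∤ M`), so `A[1/M] → B` is
defined and the slot system of `Q(x, ·) = per_n` (part A, `aeval_sumElim_eq_map_of_relations`)
transfers: `Q(x, ȳ) = per_n` over `B`, `L_B(per_n) ≤ |Q|`; finally a `ZMod p`-linear functional
`ℓ : B → ZMod p` with `ℓ(1) = 1` applied coefficientwise (Hrubeš–Yehudayoff simulation,
`CommExtSim.complexity_lmap_le`) gives the bound over `ZMod p`.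

Honest framing: glue inside a conditional route (cruxes `GeomRigidity`, `NP ⊄ P/poly` open);
`VP ≠ VNP` is NOT proved and nothing here is progress on it.
-/

set_option linter.dupNamespace false

noncomputable section

namespace Summit.ValiantsHypothesis.ValiantsHypothesis.Theorems.GaugeDescent

open MvPolynomial Literature.Computability.AlgebraicComplexity
open Summit.ValiantsHypothesis.ValiantsHypothesis.Theorems.NumTame

namespace DescentGlue

/-- In the localisation of a domain `A ⊆ ℂ` away from `x ≠ 0`, the canonical map to `ℂ` is
injective. [folklore] -/
theorem awayLift_injective (A : Subalgebra ℤ ℂ) (x : A) (hx : (x : ℂ) ≠ 0) :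
    Function.Injective
      (IsLocalization.Away.lift x (g := (algebraMap A ℂ)) (isUnit_iff_ne_zero.mpr hx) :
        Localization.Away x →+* ℂ) := by
  have hx0 : x ≠ 0 := fun h => hx (by rw [h]; rfl)
  have hinjA : Function.Injective (algebraMap A (Localization.Away x)) :=
    IsLocalization.injective (Localization.Away x) (powers_le_nonZeroDivisors_of_noZeroDivisors hx0)
  unfold IsLocalization.Away.lift
  rw [IsLocalization.lift_injective_iff]
  intro a b
  constructor
  · intro h
    rw [hinjA h]
  · intro h
    have : a = b := Subtype.ext h
    rw [this]

/-- **Reduction of a skeleton identity for `per_n` modulo a good prime.** See the module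
docstring. [cite: Burgisser2000TCS, §4 Rem. 4.6 and §5 (A3)] -/
theorem complexity_perPoly_zmod_le_of_point (K : IntermediateField ℚ ℂ) [FiniteDimensional ℚ K]
    {n μ : ℕ} (Q : ArithCircuit ℤ ((Fin n × Fin n) ⊕ Fin μ)) (hQ2 : Q.IsFanInTwo)
    (y : Fin μ → ℂ) (hyK : ∀ v, y v ∈ K)
    (hQy : aeval (Sum.elim X fun v => C (y v)) Q.eval = perPoly (Fin n) ℂ)
    (M : ℕ) (hM : 0 < M) (hint : ∀ v, ∃ e : ℕ, IsIntegral ℤ ((M : ℂ) ^ e * y v))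
    (p : ℕ) [Fact p.Prime] (hpM : ¬ p ∣ M) :
    complexity (perPoly (Fin n) (ZMod p)) ≤
      (5 * Module.finrank ℚ K ^ 3 + 6 * Module.finrank ℚ K ^ 2 + 2 * Module.finrank ℚ K) * Q.size +
        3 * Module.finrank ℚ K := by
  classical
  have hp : p.Prime := Fact.out
  have hM0 : (M : ℂ) ≠ 0 := by exact_mod_cast hM.ne'
  -- §1 one exponent for all slots; the algebraic integers `a_v = M^E y_v`
  choose e he using hint
  let E : ℕ := ∑ v, e v
  have heE : ∀ v, e v ≤ E := fun v =>
    Finset.single_le_sum (f := e) (fun _ _ => Nat.zero_le _) (Finset.mem_univ v)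
  let a : Fin μ → ℂ := fun v => (M : ℂ) ^ E * y v
  have hMint : IsIntegral ℤ ((M : ℂ)) := by
    simpa using (isIntegral_algebraMap (R := ℤ) (A := ℂ) (x := (M : ℤ)))
  have haint : ∀ v, IsIntegral ℤ (a v) := by
    intro v
    have : a v = (M : ℂ) ^ (E - e v) * ((M : ℂ) ^ e v * y v) := by
      simp only [a]
      rw [← mul_assoc, ← pow_add, Nat.sub_add_cancel (heE v)]
    rw [this]
    exact (hMint.pow _).mul (he v)
  -- §2 the ring `A = ℤ[a_v : v] ⊂ K`, finite free of rank `≤ [K:ℚ]`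
  let S : Set ℂ := Set.range a
  have hSfin : S.Finite := Set.finite_range a
  have hSint : ∀ c ∈ S, IsIntegral ℤ c := by rintro c ⟨v, rfl⟩; exact haint v
  let A : Subalgebra ℤ ℂ := Algebra.adjoin ℤ S
  haveI hAfin : Module.Finite ℤ A := Algebra.finite_adjoin_of_finite_of_isIntegral hSfin hSint
  have hAK : ∀ x : A, (x : ℂ) ∈ K := by
    have hle : A ≤ (K.toSubalgebra).restrictScalars ℤ :=
      Algebra.adjoin_le (by
        rintro c ⟨v, rfl⟩
        exact K.mul_mem (K.pow_mem (natCast_mem K M) E) (hyK v))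
    exact fun x => hle x.2
  have hAint : ∀ x : A, IsIntegral ℤ (x : ℂ) := fun x =>
    (isIntegral_algHom_iff A.val Subtype.val_injective).mpr (Algebra.IsIntegral.isIntegral x)
  haveI : Module.Free ℤ A := Module.free_of_finite_type_torsion_free'
  have hrank : Module.finrank ℤ A ≤ Module.finrank ℚ K := finrank_int_le_of_le A K hAK
  let aA : Fin μ → A := fun v => ⟨a v, Algebra.subset_adjoin ⟨v, rfl⟩⟩
  let MA : A := (M : A)
  have hMA : (MA : ℂ) = M := by simp [MA]
  have hMA0 : (MA : ℂ) ≠ 0 := by rw [hMA]; exact hM0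
  -- §3 the localisation `L = A[1/M]` and the avatar `ỹ` of `y`
  let L := Localization.Away MA
  let sE : Submonoid.powers MA := ⟨MA ^ E, E, rfl⟩
  let yL : Fin μ → L := fun v => IsLocalization.mk' L (aA v) sE
  let ι : L →+* ℂ := IsLocalization.Away.lift MA (g := algebraMap A ℂ) (isUnit_iff_ne_zero.mpr hMA0)
  have hιinj : Function.Injective ι := awayLift_injective A MA hMA0
  have hιy : ∀ v, ι (yL v) = y v := by
    intro v
    show IsLocalization.Away.lift MA _ (IsLocalization.mk' L (aA v) sE) = y v
    unfold IsLocalization.Away.lift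
    rw [IsLocalization.lift_mk'_spec]
    show ((aA v : A) : ℂ) = ((MA ^ E : A) : ℂ) * y v
    simp [aA, a, MA]
  have hrelL := fun (P : MvPolynomial (Fin μ) ℤ) (hP : aeval y P = 0) =>
    relations_of_injective ι hιinj yL P (by
      rw [show (fun b => ι (yL b)) = y from funext hιy]
      exact hP)
  -- §4 the quotient `B = A/pA`, a finite `ZMod p`-algebra of dimension `≤ [K:ℚ]`, `M` a unit
  let I : Ideal A := Ideal.span ({(p : A)} : Set A)
  let B := A ⧸ I
  let π : A →+* B := Ideal.Quotient.mk I
  have hpunit : ¬ IsUnit ((p : A)) := not_isUnit_natCast_prime A hAint p hp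
  haveI hchar : CharP B p := CharP.quotient A p (mem_nonunits_iff.mpr hpunit)
  letI : Algebra (ZMod p) B := ZMod.algebra B p
  haveI : Nontrivial B := CharP.nontrivial_of_char_ne_one hp.ne_one
  obtain ⟨hBfin, hBrank⟩ := finite_and_finrank_zmod_quotient_le A I p
  haveI := hBfin
  have hMB : IsUnit (π MA) := by
    have h1 : (M : ZMod p) ≠ 0 := by
      rw [Ne, ZMod.natCast_eq_zero_iff]
      exact hpM
    have h2 := (isUnit_iff_ne_zero.mpr h1).map (algebraMap (ZMod p) B)
    rw [map_natCast] at h2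
    have h3 : π MA = (M : B) := by simp [MA, π]
    rwa [h3]
  let φ : L →+* B := IsLocalization.Away.lift MA (g := π) hMB
  let yB : Fin μ → B := fun v => φ (yL v)
  have hrelB : ∀ P : MvPolynomial (Fin μ) ℤ, aeval y P = 0 → aeval yB P = 0 :=
    fun P hP => relations_of_ringHom φ yL P (hrelL P hP)
  -- §5 the identity over `B` and `L_B(per_n) ≤ |Q|`
  have hQyZ : aeval (Sum.elim X fun v => C (y v)) Q.eval =
      MvPolynomial.map (Int.castRingHom ℂ) (perPoly (Fin n) ℤ) := by
    rw [hQy, map_perPoly]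
  have hQB : aeval (Sum.elim X fun v => C (yB v)) Q.eval =
      MvPolynomial.map (Int.castRingHom B) (perPoly (Fin n) ℤ) :=
    aeval_sumElim_eq_map_of_relations Q.eval (perPoly (Fin n) ℤ) y yB hrelB hQyZ
  rw [map_perPoly] at hQB
  have hcB : complexity (perPoly (Fin n) B) ≤ Q.size := by
    rw [← hQB]
    have hproj : IsProjection (aeval (Sum.elim X fun v => C (yB v)) Q.eval)
        (MvPolynomial.map (Int.castRingHom B) Q.eval) := by
      refine ⟨Sum.elim X fun v => C (yB v), fun i => ?_, ?_⟩
      · rcases i with i | v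
        · exact Or.inl ⟨i, rfl⟩
        · exact Or.inr ⟨yB v, rfl⟩
      · rw [show Int.castRingHom B = algebraMap ℤ B from Subsingleton.elim _ _,
          aeval_map_algebraMap]
    calc complexity (aeval (Sum.elim X fun v => C (yB v)) Q.eval)
        ≤ complexity (MvPolynomial.map (Int.castRingHom B) Q.eval) :=
          complexity_le_of_isProjection hproj
      _ ≤ complexity Q.eval := ArithCircuit.complexity_map_le _ _
      _ ≤ Q.size := ArithCircuit.complexity_le_size hQ2 rfl
  -- §6 a functional with `ℓ 1 = 1` and the Hrubeš–Yehudayoff simulation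
  obtain ⟨ψ, hψ⟩ : ∃ ψ : Module.Dual (ZMod p) B, ψ 1 ≠ 0 := by
    by_contra h
    push Not at h
    exact one_ne_zero ((Module.forall_dual_apply_eq_zero_iff (ZMod p) (1 : B)).1 h)
  let ℓ : B →ₗ[ZMod p] ZMod p := (ψ 1)⁻¹ • ψ
  have hℓ1 : ℓ 1 = 1 := by
    simp only [ℓ, LinearMap.smul_apply, smul_eq_mul, inv_mul_cancel₀ hψ]
  have hq : CommExtSim.lmap ℓ (perPoly (Fin n) B) = perPoly (Fin n) (ZMod p) := by
    have h := CommExtSim.lmap_C_mul_map ℓ (1 : B) (perPoly (Fin n) (ZMod p))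
    rw [C_1, one_mul, map_perPoly, hℓ1, one_smul] at h
    exact h
  have h := CommExtSim.complexity_lmap_le (Module.finBasis (ZMod p) B) ℓ (perPoly (Fin n) B)
  rw [hq, Fintype.card_fin] at h
  set d := Module.finrank (ZMod p) B
  have hdD : d ≤ Module.finrank ℚ K := hBrank.trans hrank
  refine h.trans ?_
  calc (5 * d ^ 3 + 6 * d ^ 2 + 2 * d) * complexity (perPoly (Fin n) B) + 3 * d
      ≤ (5 * d ^ 3 + 6 * d ^ 2 + 2 * d) * Q.size + 3 * d := by gcongr
    _ ≤ _ := by gcongr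

end DescentGlue

end Summit.ValiantsHypothesis.ValiantsHypothesis.Theorems.GaugeDescent

end
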